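import Mathlib.Analysis.SpecialFunctions.Pow.Real
import HarnessLib

/-!
# The fork at [IUTchIII] Corollary 3.12 — LOCAL versus GLOBAL, in the real numbers of [IUTchIV] Thm. 1.10 Step (v) (skeleton XXIVc)

Record-only file (D-0012) of the abc-iut cell (skeleton seat abc-iut-skel, gen 4); TAKES NO SIDE. Companion of XXIV
`ForkLocalGlobal` (`perPlace_bound_of_pointwise`: a per-packet reading of Step (xi) composed with a per-packet upper bound
is a per-place bound) — here with the PRINTED coefficients of the upper bound, so that the arithmetic of the local horn
is kernel-checked in the real-number shadow of [IUTchIV] Theorem 1.10 (S. Mochizuki, *Inter-universal Teichmüller theory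
IV*, kurims Apr 2020 = `paper:url-56bcb0f95768`), exactly as skeleton III `ForkThm110` shadows its global display.

WHAT THE PAGE PRINTS (read on this seat's render). Step (iv) p. 27: "we proceed to estimate this log-volume at each
`v_ℚ ∈ 𝕍_ℚ`. Once one fixes `v_ℚ`, this amounts to estimating the component of this log-volume in `𝓘^ℚ(^{S^±_{j+1}};^{n,∘}𝒟^⊢_{v_ℚ})`
… for each `j ∈ {1, …, l⋇}` … and then computing the average, over `j`". Step (v) p. 29, for `v_ℚ ∈ 𝕍^dst_ℚ`, after
averaging over `j ∈ 𝔽_l^⋇`, the "procession-normalized upper bound"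
`(l+5)/4·log(𝔡^K_{v_ℚ}) − (l+1)/24·log(𝔮_{v_ℚ}) + log(𝔰^ℚ_{v_ℚ}) + (l+5)·l*_mod·log(𝔰^≤_{v_ℚ})`; Step (vi) p. 29 (other
nonarchimedean `v_ℚ`): bound `0`; Step (vii) p. 30 (archimedean): `(l+5)/4·log(π)`; Step (viii) p. 30: "it suffices to
sum over `v_ℚ ∈ 𝕍_ℚ` the various local "procession-normalized upper bounds"", the `q`-side being "`C_Θ·|log(q)|`, i.e., the
product of `C_Θ` and `(1/2l)·log(q)`" with `log(q) = Σ_{v_ℚ} log(𝔮_{v_ℚ})` supported on the bad places. So at ONE place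
`v_ℚ = p` the Θ-side component is bounded by `κ_p − (l+1)/24·log(𝔮_p)` with
`κ_p := (l+5)/4·log(𝔡^K_p) + log(𝔰^ℚ_p) + (l+5)·l*_mod·log(𝔰^≤_p) ≥ 0` INDEPENDENT of `log(𝔮_p)`, and the `q`-side component is
`−(1/2l)·log(𝔮_p)`; [IUTchI] Def. 3.1 (c) constrains `ord_v(q_v)` only by coprimality with `l` (tree
`Literature.IUT.HodgeTheaters.InitialThetaData.l_coprime_qParamOrd`), so `log(𝔮_p)` is unbounded over initial Θ-data.

PROVED here (real arithmetic with these coefficients; `StepVPlace` = the per-place numbers, `localTheta ≤ κ − (l+1)/24·logq`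
the Step (v) bound as a HYPOTHESIS on the shadow, never asserted for the real setting):
* `coeff_pos` — `(l+1)/24 − 1/(2l) > 0` for `l ≥ 4` (for the cell's `l ≥ 7`: the per-place `q`-coefficient beats the
  `q`-side's `1/2l`);
* `logq_le_of_perPlace` — the PER-PLACE reading "`q`-side component `≤` Θ-side component at `p`" (Reading 0 summed over
  labels at one place; weaker than every per-packet reading of XXIV) together with the Step (v) bound at `p` forces
  `log(𝔮_p) ≤ κ_p / ((l+1)/24 − 1/(2l))` — a bound on the local height at `p` by the local different/conductor/`l` terms;
* `not_perPlace_of_deep` — conversely, a place with `log(𝔮_p)` beyond that threshold VIOLATES the per-place reading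
  whenever the Step (v) bound holds there;
* `global_of_compensation` / `localGlobal_numbers` — while the GLOBAL comparison (sum over places: the deep bad place `p`
  plus the aggregate `B_rest ≥ 0` of the bounds at the other places of `𝕍^dst_ℚ`, where the `q`-side vanishes — for the
  family "j-invariant `p^{−N}·u`" these are the ramified primes of `K ⊇ F(E[l])`, growing with the conductor of `E`: the
  abc shape) HOLDS as soon as `B_rest` covers the deficit. Both at once: `localGlobal_numbers` exhibits, for every `l ≥ 7`,
  `κ_p ≥ 0` and deficit, shadow numbers with the Step (v) bounds in force, the global inequality TRUE and the per-place
  reading at `p` FALSE.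

HONEST SCOPE: this is the real-number shadow with the printed coefficients, like `ForkThm110`; that the assembled real
setting's `qLocal`/`thetaLocal` instantiate these numbers (campaign S / c312-3 / c312-d1: `Thm110*`, `LDH*`,
`TensorPacketStepV`) is NOT claimed here. [claim: Mochizuki2012, status: disputed]
Deliberately NOT here: anything about the intended instantiation; any judgement on Cor. 3.12.
-/

noncomputable section

namespace Summit.ABC

namespace IUTFork

namespace LocalGlobalNumbers

/-! ## 1. The per-place numbers of Step (v) and the two components at one place -/

/-- The real numbers of [IUTchIV] Thm. 1.10 Step (v) at ONE place `v_ℚ = p ∈ 𝕍^dst_ℚ` (p. 28–29), in the shadow: the prime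
`l`, the `log(𝔮_p)`-free part `κ_p` of the procession-normalized upper bound, the local `q`-degree `log(𝔮_p)`, and the
Θ-side component `localTheta` (the procession-normalized hull log-volume at `p`). [claim: Mochizuki2012, status: disputed] -/
structure StepVPlace where
  /-- the prime `l` (`l ≥ 7` in Thm. 1.10: [IUTchI] Def. 3.1 (c) `l ≥ 5` and `l ≠ 5`) -/
  l : ℕ
  /-- `l ≥ 7` -/
  seven_le_l : 7 ≤ l
  /-- `κ_p = (l+5)/4·log(𝔡^K_p) + log(𝔰^ℚ_p) + (l+5)·l*_mod·log(𝔰^≤_p)` — independent of `log(𝔮_p)` -/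
  kappa : ℝ
  /-- `κ_p ≥ 0` (all three printed terms are `≥ 0`) -/
  kappa_nonneg : 0 ≤ kappa
  /-- `log(𝔮_p) ≥ 0`, the `p`-component of the degree of the `q`-parameter divisor -/
  logq : ℝ
  /-- nonnegativity, as printed (`log(q) ∈ ℝ_{≥0}`) -/
  logq_nonneg : 0 ≤ logq
  /-- the Θ-side component at `p`: the procession-normalized hull log-volume summed over `v | p` -/
  localTheta : ℝ

namespace StepVPlace

variable (d : StepVPlace)

/-- The `q`-side component at `p`: `−(1/2l)·log(𝔮_p)` ("`|log(q)| = (1/2l)·log(q)`", p. 22; Step (viii) p. 30).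
[claim: Mochizuki2012, status: disputed] -/
def qSide : ℝ := -(1 / (2 * (d.l : ℝ))) * d.logq

/-- **The Step (v) upper bound at `p`** (p. 29 display, procession-normalized): `localTheta ≤ κ_p − (l+1)/24·log(𝔮_p)`.
HYPOTHESIS on the shadow (the content of [IUTchIV] Props. 1.2–1.4 + Step (v)); never asserted for the real setting.
[claim: Mochizuki2012, status: disputed] -/
@[claim "Mochizuki2012" "disputed"] def StepVBound : Prop :=
  d.localTheta ≤ d.kappa - (d.l + 1) / 24 * d.logq

/-- **The PER-PLACE reading at `p`**: the `q`-side component at `p` is at most the Θ-side component at `p` (Reading 0 of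
`Cor312ReadingIso` summed over the labels `j ∈ 𝔽_l^⋇` at the one place — implied by every per-packet reading of XXIV).
[claim: Mochizuki2012, status: disputed] -/
@[claim "Mochizuki2012" "disputed"] def PerPlace : Prop := d.qSide ≤ d.localTheta

/-! ## 2. The local horn with the printed coefficients -/

/-- The per-place `q`-coefficient of the Step (v) bound beats the `q`-side's: `(l+1)/24 − 1/(2l) > 0` (for `l ≥ 4`; here
`l ≥ 7`). [folklore] -/
theorem coeff_pos : 0 < ((d.l : ℝ) + 1) / 24 - 1 / (2 * (d.l : ℝ)) := by
  have hl : (7 : ℝ) ≤ d.l := by exact_mod_cast d.seven_le_l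
  have hl0 : (0 : ℝ) < d.l := by linarith
  rw [div_sub_div _ _ (by norm_num : (24 : ℝ) ≠ 0) (by positivity : (2 * (d.l : ℝ)) ≠ 0)]
  apply div_pos _ (by positivity)
  nlinarith

/-- **Per-place reading ∘ Step (v) bound at `p` ⟹ a bound on the local height at `p`:**
`log(𝔮_p) ≤ κ_p / ((l+1)/24 − 1/(2l))`. [claim: Mochizuki2012, status: disputed] -/
theorem logq_le_of_perPlace (hB : d.StepVBound) (hR : d.PerPlace) :
    d.logq ≤ d.kappa / (((d.l : ℝ) + 1) / 24 - 1 / (2 * (d.l : ℝ))) := by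
  rw [le_div_iff₀ d.coeff_pos]
  unfold PerPlace qSide at hR
  unfold StepVBound at hB
  nlinarith

/-- **Conversely: a DEEP place violates the per-place reading.** If the Step (v) bound holds at `p` and
`log(𝔮_p) > κ_p / ((l+1)/24 − 1/(2l))`, the per-place reading FAILS at `p` — whatever happens at the other places.
[claim: Mochizuki2012, status: disputed] -/
theorem not_perPlace_of_deep (hB : d.StepVBound)
    (hdeep : d.kappa / (((d.l : ℝ) + 1) / 24 - 1 / (2 * (d.l : ℝ))) < d.logq) : ¬ d.PerPlace :=
  fun hR => lt_irrefl _ (lt_of_lt_of_le hdeep (d.logq_le_of_perPlace hB hR))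

end StepVPlace

/-! ## 3. The global comparison compensates: deep place against the rest -/

/-- The shadow of the GLOBAL comparison of Step (viii) (p. 30: "sum over `v_ℚ ∈ 𝕍_ℚ` the various local procession-normalized
upper bounds") split as ONE deep bad place `p` + THE REST: `B_rest ≥ 0` aggregates the bounds at the other places of
`𝕍^dst_ℚ ∪ 𝕍^arc_ℚ` (Steps (v)–(vii): `q`-side zero there, Θ-side bound `≥ 0`), `restTheta` the Θ-side components there.
[claim: Mochizuki2012, status: disputed] -/
structure GlobalShadow extends StepVPlace where
  /-- the Θ-side components summed over the places other than `p` -/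
  restTheta : ℝ
  /-- the sum of the Step (v)/(vi)/(vii) bounds at the places other than `p` -/
  Brest : ℝ
  /-- those bounds are nonnegative -/
  Brest_nonneg : 0 ≤ Brest
  /-- the bounds hold there -/
  rest_le : restTheta ≤ Brest

namespace GlobalShadow

variable (g : GlobalShadow)

/-- **The GLOBAL reading** (= the Corollary's inequality in the shadow): `−|log(q)| ≤ −|log(Θ)|`, i.e. the `q`-side at `p`
(zero elsewhere) is at most the total Θ-side. [claim: Mochizuki2012, status: disputed] -/
@[claim "Mochizuki2012" "disputed"] def Global : Prop := g.qSide ≤ g.localTheta + g.restTheta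

/-- The per-place reading at `p` together with `restTheta ≥ 0` gives the global one (local ⟹ global, as in XXIV).
[folklore] -/
theorem global_of_perPlace (hR : g.PerPlace) (hrest : 0 ≤ g.restTheta) : g.Global := by
  unfold Global
  unfold StepVPlace.PerPlace at hR
  linarith

/-- **COMPENSATION**: if the Θ-side at `p` ATTAINS its Step (v) bound and the rest attains `B_rest`, the global reading
holds as soon as `B_rest` covers the deficit `((l+1)/24 − 1/(2l))·log(𝔮_p) − κ_p` of the deep place. (For the family
"j-invariant `p^{−N}·u`" the rest is carried by the ramified primes of `K`, which grow with the conductor — the abc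
shape; here `B_rest` is a free parameter.) [claim: Mochizuki2012, status: disputed] -/
theorem global_of_compensation (hp : g.localTheta = g.kappa - (g.l + 1) / 24 * g.logq) (hr : g.restTheta = g.Brest)
    (hcomp : (((g.l : ℝ) + 1) / 24 - 1 / (2 * (g.l : ℝ))) * g.logq - g.kappa ≤ g.Brest) : g.Global := by
  unfold Global StepVPlace.qSide
  rw [hp, hr]
  have hl : (7 : ℝ) ≤ g.l := by exact_mod_cast g.seven_le_l
  have hl0 : (0 : ℝ) < 2 * (g.l : ℝ) := by linarith
  have key : (((g.l : ℝ) + 1) / 24 - 1 / (2 * (g.l : ℝ))) * g.logq =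
      ((g.l : ℝ) + 1) / 24 * g.logq - 1 / (2 * (g.l : ℝ)) * g.logq := by ring
  linarith

end GlobalShadow

/-- **THE LOCAL/GLOBAL FORK IN THE PRINTED NUMBERS.** For every `l ≥ 7`, every `κ ≥ 0` and every depth `N` beyond the
per-place threshold `κ / ((l+1)/24 − 1/(2l))`, there are shadow numbers — Step (v) bound attained at the deep place
`p` (`log(𝔮_p) = N`), the rest attaining a compensating `B_rest` — in which the Step (v) bounds hold, the GLOBAL reading
(the Corollary's inequality) is TRUE and the PER-PLACE reading at `p` is FALSE. So, with the printed coefficients, no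
per-place (a fortiori no per-packet) reading of Step (xi) follows from the Corollary, and each per-place reading asserts
a local height bound that deep places violate. [claim: Mochizuki2012, status: disputed] -/
theorem localGlobal_numbers (l : ℕ) (hl : 7 ≤ l) (κ : ℝ) (hκ : 0 ≤ κ) (N : ℝ)
    (hN : κ / (((l : ℝ) + 1) / 24 - 1 / (2 * (l : ℝ))) < N) :
    ∃ g : GlobalShadow, g.l = l ∧ g.kappa = κ ∧ g.logq = N ∧ g.StepVBound ∧ g.restTheta ≤ g.Brest ∧
      g.Global ∧ ¬ g.PerPlace := by
  have hcoeff : 0 < ((l : ℝ) + 1) / 24 - 1 / (2 * (l : ℝ)) := by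
    have hl' : (7 : ℝ) ≤ l := by exact_mod_cast hl
    have hl0 : (0 : ℝ) < l := by linarith
    rw [div_sub_div _ _ (by norm_num : (24 : ℝ) ≠ 0) (by positivity : (2 * (l : ℝ)) ≠ 0)]
    apply div_pos _ (by positivity)
    nlinarith
  have hN0 : 0 ≤ N := le_of_lt (lt_of_le_of_lt (div_nonneg hκ hcoeff.le) hN)
  have hdef : 0 ≤ (((l : ℝ) + 1) / 24 - 1 / (2 * (l : ℝ))) * N - κ := by
    have := (div_lt_iff₀ hcoeff).mp hN
    linarith
  let d : StepVPlace :=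
    { l := l, seven_le_l := hl, kappa := κ, kappa_nonneg := hκ, logq := N, logq_nonneg := hN0,
      localTheta := κ - (l + 1) / 24 * N }
  let g : GlobalShadow :=
    { d with
      restTheta := (((l : ℝ) + 1) / 24 - 1 / (2 * (l : ℝ))) * N - κ
      Brest := (((l : ℝ) + 1) / 24 - 1 / (2 * (l : ℝ))) * N - κ
      Brest_nonneg := hdef
      rest_le := le_rfl }
  refine ⟨g, rfl, rfl, rfl, le_rfl, le_rfl, ?_, ?_⟩
  · exact g.global_of_compensation rfl rfl le_rfl
  · exact g.not_perPlace_of_deep (le_refl _) hN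

/-- The threshold is finite and explicit: `κ / ((l+1)/24 − 1/(2l)) = 24·l·κ / (l² + l − 12)` (for `l = 7`: `42κ/11`).
[folklore] -/
theorem threshold_closed_form (l : ℕ) (hl : 7 ≤ l) (κ : ℝ) :
    κ / (((l : ℝ) + 1) / 24 - 1 / (2 * (l : ℝ))) = 24 * l * κ / ((l : ℝ) ^ 2 + l - 12) := by
  have hl' : (7 : ℝ) ≤ l := by exact_mod_cast hl
  have hl0 : (l : ℝ) ≠ 0 := by positivity
  have hden : ((l : ℝ) + 1) / 24 - 1 / (2 * (l : ℝ)) = ((l : ℝ) ^ 2 + l - 12) / (24 * l) := by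
    field_simp
    ring
  rw [hden, div_div_eq_mul_div]
  ring

end LocalGlobalNumbers

end IUTFork

end Summit.ABC

end
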